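import Summits.QuantumFields.BalabanUV.T4Continuum.Support.NE3ExactLineSumsTower
import Summits.QuantumFields.BalabanUV.T4Continuum.Support.NE3CovariantLineSumsL2Tower
import HarnessLib

/-!
# T⁴ programme, node NE3, route H♮ (ρ-g22-2) · row K3 (file 3) — THE ACCUMULATED TRANSPORT MISMATCH OF THE TOWER IN ℓ²(TORUS):
# `Σ_{z∈periodBox N} Σ_κ ‖DefIter L (j+1) W ζ z κ‖² ≤ d·(20·loopRad(d,L,r_j))²·(L^d)^{−(j+1)}·Σ_{x∈periodBox (L^{j+1}·N)} ‖ζ x‖²`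
# — the block-mean GAIN `M^{−d}` survives exactly (`M = L^{j+1}`), k-FREE, top radius `r_j = (prop1Radius)^[j] x` only

NE3 formalisation swarm `b2b-balaban-t4-ne3-formalise-*`, LEAF PROVER 04 (gen 5), row **K3** of the owner's design ρ-g22-2 (memo
`HOME/t4/b2b-balaban-t4-ne3-p1/g22/D-ne3p1-g22-1.md` §2 S3: `Σ‖def(ζ′)‖² ≤ C·(b∕L²)²·M^{−d}·Σ‖ζ′‖²` is how the core of S4 and the data
defect of S7 consume the mismatch; requested in this currency by row NE3-R2's disprover note D-ne3r2-g7-4 (HOME/CLAIMS.log l.18222):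
«the sup currency is not what H♮ consumes — the ℓ² twin with the block-mean gain M^{−d} is NEEDED»).  File 1 (`NE3ExactLineSums`,
p228292) = one level incl. its ℓ² form; file 2 (`NE3ExactLineSumsTower`) = the exact tower identity `QstrIter L j W (gaugeDir W ζ) =
gaugeDir (cavgIter L j W) (bmeanIterW L j W ζ) + DefIter L j W ζ`, the sup bound and the level sum `DSum`.

CONTENT (all [folklore]; 0 sorry; 0 def):
§1 `sum_norm_bmeanW_sq_le` — ONE TRANSPORTED BLOCK MEAN IN ℓ²: `Σ_{z∈periodBox P} ‖bmeanW L W μ z‖² ≤ (L^d)⁻¹·Σ_{x∈periodBox (L·P)} ‖μ x‖²`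
   (unitary `W`; Jensen on the block + tiling — no periodicity needed); `rho_eq` (`rho d L = L·(√(L^d))⁻¹`), `sqrt_defect_l2_le` (file 1 §5 under a root).
§2 **`sqrt_l2sq_DefIter_le`** — in the multi-level small-field class (`IsUnitaryCfg W`, `IsPeriodicCfg W (tower L N (j+1))`, `0 ≤ x`,
   `LevelSmall d L j x`, `SmallField W x`) and for a `tower L N (j+1)`-periodic generator `ζ`:
   `√(l2sq (periodBox N) (DefIter L (j+1) W ζ)) ≤ √d·DSum d L (j+1) x·((√(L^d))⁻¹)^{j+1}·√(Σ_{x∈periodBox (tower L N (j+1))} ‖ζ x‖²)`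
   — Minkowski (`sqrt_l2sq_add_le`), the IH at `cavg L W` on `bmeanW L W ζ` (§1 gives one factor `(√(L^d))⁻¹`), the finest defect carried by
   C1 file 5's `sqrt_l2sq_QstrIter_le` (`ρ^{j} = L^{j}·(√(L^d))^{−j}`: the straight averages' ℓ² weight) — the SAME geometric series `DSum`
   as in sup currency, with the block-mean gain kept.
§3 **`l2sq_DefIter_le_of_levelSmall`** (`L ≥ 2`): `l2sq (periodBox N) (DefIter L (j+1) W ζ) ≤ d·(20·loopRad d L ((prop1Radius d L)^[j] x))²·
   ((L^d)⁻¹)^{j+1}·Σ_{x∈periodBox (tower L N (j+1))} ‖ζ x‖²` (file 2 `DSum_le_top`).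

HONEST: multi-level covariant kinematics on OUR frame; nothing about Bałaban's minimisers; (P♮)_W, (ML_w) at W ≠ 1, T-E_w, NE3 NOT proved;
spine PROVED 0∕9; finite T⁴ rung (B)+1 — NOT infinite volume, NOT mass gap, NOT BetaPertH, NOT Clay.  PLACEMENT: `Summits/QuantumFields/BalabanUV/`.
-/

set_option autoImplicit false

open scoped BigOperators Matrix.Norms.L2Operator
open Finset

namespace Summit.QuantumFields.BalabanUV.T4Continuum.NE3ExactLineSumsL2

open Literature.MathematicalPhysics.QuantumFieldTheory.Balaban1983to89
open B7Prop1Explicit B7Prop2Explicit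
open T4AveragingDeficitWall (IsUnitaryCfg SmallField Ad)
open T4AveragingDeficitWallBoundary (IsPeriodicCfg periodBox)
open AveragingDeficitPeriodicCounting (IsPeriodicDir)
open AveragingDeficitTransport (norm_Ad_of_unitary)
open AveragingDeficitChartCalculus (cavg)
open AveragingDeficitMultiLevelPrep (cavgIter tower LevelSmall natCast_tower_succ prop1Radius_nonneg)
open AveragingDeficitTwoLevelPrep (prop1Radius)
open BlockAveragePushDirGauge (gaugeDir isPeriodicDir_gaugeDir)
open NE3TangentCovariantTower (step_small)
open NE3CovariantLineSums (Qstr)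
open NE3CovariantLineSumsTower (QstrIter QstrIter_succ QstrIter_zero)
open NE3CovariantLineSumsL2 (l2sq l2sq_nonneg sqrt_l2sq_add_le)
open NE3CovariantLineSumsL2Tower (rho rho_nonneg periodic_step sqrt_l2sq_QstrIter_le)
open NE3CovariantBlockMean (bmeanW bmeanW_add_period)
open NE3ExactLineSums (blockMean_norm_sq_le sum_norm_Qstr_gaugeDir_sub_sq_le)
open NE3ExactLineSumsTower (DefIter DefIter_succ DefIter_zero DSum DSum_succ DSum_nonneg DSum_le_top)
open NE3BlockLineAverage (sum_univ_boxVec sum_periodBox_blocks)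
open SpreadLift (loopRad)

noncomputable section

variable {d : ℕ} {n : Type*} [Fintype n] [DecidableEq n]

/-! ## §1 One transported block mean in ℓ²; bookkeeping -/

/-- **ONE TRANSPORTED BLOCK MEAN IN ℓ²** (unitary `W`, `L ≥ 1`, any `P`):
`Σ_{z∈periodBox P} ‖bmeanW L W μ z‖² ≤ (L^d)⁻¹·Σ_{x∈periodBox (L·P)} ‖μ x‖²` — Jensen on each block, then the blocks tile. [folklore] -/
theorem sum_norm_bmeanW_sq_le {L : ℕ} (hL : 1 ≤ L) (P : ℕ) {W : Site d → Fin d → (Matrix n n ℂ)ˣ} (hWu : IsUnitaryCfg W)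
    (mu : Site d → Matrix n n ℂ) :
    ∑ z ∈ periodBox (d := d) P, ‖bmeanW L W mu z‖ ^ 2 ≤ ((L : ℝ) ^ d)⁻¹ * ∑ x ∈ periodBox (d := d) (L * P), ‖mu x‖ ^ 2 := by
  -- pointwise Jensen
  have hpt : ∀ z : Site d, ‖bmeanW L W mu z‖ ^ 2
      ≤ ((L : ℝ) ^ d)⁻¹ * ∑ r : Fin d → Fin L, ‖mu ((L : ℤ) • z + boxVec L r)‖ ^ 2 := by
    intro z
    have h1 : ‖bmeanW L W mu z‖ ≤ ∑ r : Fin d → Fin L, (((L : ℝ) ^ d)⁻¹) * ‖mu ((L : ℤ) • z + boxVec L r)‖ := by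
      unfold bmeanW
      refine (norm_sum_le _ _).trans (Finset.sum_le_sum fun r _ => ?_)
      rw [norm_smul, Real.norm_eq_abs, abs_of_nonneg (by positivity), norm_Ad_of_unitary (hol_mem_of hWu _ _)]
    exact (pow_le_pow_left₀ (norm_nonneg _) h1 2).trans (blockMean_norm_sq_le (n := n) hL mu ((L : ℤ) • z))
  calc ∑ z ∈ periodBox (d := d) P, ‖bmeanW L W mu z‖ ^ 2
      ≤ ∑ z ∈ periodBox (d := d) P, ((L : ℝ) ^ d)⁻¹ * ∑ r : Fin d → Fin L, ‖mu ((L : ℤ) • z + boxVec L r)‖ ^ 2 :=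
        Finset.sum_le_sum fun z _ => hpt z
    _ = ((L : ℝ) ^ d)⁻¹ * ∑ x ∈ periodBox (d := d) (L * P), ‖mu x‖ ^ 2 := by
        rw [← Finset.mul_sum, ← sum_periodBox_blocks L P hL (fun x => ‖mu x‖ ^ 2)]
        congr 1
        exact Finset.sum_congr rfl fun z _ => sum_univ_boxVec L (fun v => ‖mu ((L : ℤ) • z + v)‖ ^ 2)

omit [Fintype n] [DecidableEq n] in
/-- `rho d L = L·(√(L^d))⁻¹` (`rho = √(L²∕L^d)`). [folklore] -/
theorem rho_eq (d L : ℕ) : rho d L = (L : ℝ) * (Real.sqrt ((L : ℝ) ^ d))⁻¹ := by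
  unfold rho
  rw [Real.sqrt_div' _ (by positivity), Real.sqrt_sq (by positivity), div_eq_mul_inv]

omit [Fintype n] [DecidableEq n] in
/-- `((√(L^d))⁻¹)² = (L^d)⁻¹`. [folklore] -/
theorem sqrtInv_sq (d L : ℕ) : ((Real.sqrt ((L : ℝ) ^ d))⁻¹) ^ 2 = ((L : ℝ) ^ d)⁻¹ := by
  rw [inv_pow, Real.sq_sqrt (by positivity)]

/-- File 1 §5 under a square root: for an `(L·N′)`-periodic `ζ` in the one-level small-field class,
`√(l2sq (periodBox N′) def(ζ)) ≤ √d·(10·loopRad d L a)·(√(L^d))⁻¹·√(Σ_{x∈periodBox (L·N′)} ‖ζ x‖²)`. [folklore] -/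
theorem sqrt_defect_l2_le [Nonempty n] {L : ℕ} (hL : 1 ≤ L) {N' : ℕ} (hN' : 1 ≤ N') {W : Site d → Fin d → (Matrix n n ℂ)ˣ}
    (hWu : IsUnitaryCfg W) {a : ℝ} (ha : 0 ≤ a) (h512 : 512 * (d + 1) * (d + 4) * (L : ℝ) ^ 2 * a ≤ 1) (hWa : SmallField W a)
    (ζ : Site d → Matrix n n ℂ) (hζ : ∀ (x : Site d) (τ : Fin d), ζ (x + ((L * N' : ℕ) : ℤ) • e τ) = ζ x) :
    Real.sqrt (l2sq (periodBox (d := d) N')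
        (fun z κ => Qstr L W (gaugeDir W ζ) z κ - gaugeDir (cavg L W) (bmeanW L W ζ) z κ))
      ≤ Real.sqrt d * (10 * loopRad d L a) * (Real.sqrt ((L : ℝ) ^ d))⁻¹
          * Real.sqrt (∑ x ∈ periodBox (d := d) (L * N'), ‖ζ x‖ ^ 2) := by
  have h := sum_norm_Qstr_gaugeDir_sub_sq_le hL hWu ha h512 hWa hN' ζ hζ
  have hρ : 0 ≤ 10 * loopRad d L a := by unfold loopRad; positivity
  have hS : 0 ≤ ∑ x ∈ periodBox (d := d) (L * N'), ‖ζ x‖ ^ 2 := by positivity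
  have hrhs : Real.sqrt d * (10 * loopRad d L a) * (Real.sqrt ((L : ℝ) ^ d))⁻¹
          * Real.sqrt (∑ x ∈ periodBox (d := d) (L * N'), ‖ζ x‖ ^ 2)
      = Real.sqrt ((d : ℝ) * (10 * loopRad d L a) ^ 2 * ((L : ℝ) ^ d)⁻¹ * ∑ x ∈ periodBox (d := d) (L * N'), ‖ζ x‖ ^ 2) := by
    rw [Real.sqrt_mul (by positivity), Real.sqrt_mul (by positivity), Real.sqrt_mul (by positivity), Real.sqrt_sq hρ,
      Real.sqrt_inv]
  rw [hrhs]
  refine Real.sqrt_le_sqrt ?_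
  unfold l2sq
  exact h

/-! ## §2 The tower in ℓ² -/

/-- **THE ACCUMULATED TRANSPORT MISMATCH IN ℓ²(TORUS)**: in the multi-level small-field class (`IsUnitaryCfg W`,
`IsPeriodicCfg W (tower L N (j+1))`, `0 ≤ x`, `LevelSmall d L j x`, `SmallField W x`) and for a `tower L N (j+1)`-periodic generator `ζ`:
`√(l2sq (periodBox N) (DefIter L (j+1) W ζ)) ≤ √d·DSum d L (j+1) x·((√(L^d))⁻¹)^{j+1}·√(Σ_{x∈periodBox (tower L N (j+1))} ‖ζ x‖²)`
— the block-mean gain `(L^d)^{−(j+1)/2}` is kept exactly; the prefactor is file 2's level sum. [folklore] -/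
theorem sqrt_l2sq_DefIter_le [Nonempty n] {L N : ℕ} (hL : 1 ≤ L) (hN : 1 ≤ N) (j : ℕ) :
    ∀ {W : Site d → Fin d → (Matrix n n ℂ)ˣ} {x : ℝ}, IsUnitaryCfg W → IsPeriodicCfg W ((tower L N (j + 1) : ℕ) : ℤ) → 0 ≤ x →
    LevelSmall d L j x → SmallField W x →
    ∀ {ζ : Site d → Matrix n n ℂ}, (∀ (y : Site d) (τ : Fin d), ζ (y + ((tower L N (j + 1) : ℕ) : ℤ) • e τ) = ζ y) →
      Real.sqrt (l2sq (periodBox (d := d) N) (DefIter L (j + 1) W ζ))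
        ≤ Real.sqrt d * DSum d L (j + 1) x * ((Real.sqrt ((L : ℝ) ^ d))⁻¹) ^ (j + 1)
          * Real.sqrt (∑ y ∈ periodBox (d := d) (tower L N (j + 1)), ‖ζ y‖ ^ 2) := by
  induction j with
  | zero =>
      intro W x hWu hWP hx hsm hWx ζ hζ
      obtain ⟨h512, -, -, -⟩ := step_small hL hWu hx hsm hWx
      have hE : DefIter L (0 + 1) W ζ
          = fun z κ => Qstr L W (gaugeDir W ζ) z κ - gaugeDir (cavg L W) (bmeanW L W ζ) z κ := by
        rw [zero_add, DefIter_succ]; funext z κ; simp only [DefIter_zero, QstrIter_zero, zero_add]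
      have hS : DSum d L (0 + 1) x = 10 * loopRad d L x := by
        rw [zero_add, DSum_succ]; simp only [pow_zero, one_mul, DSum, add_zero]
      rw [hE, hS, zero_add, pow_one]
      have hζ' : ∀ (y : Site d) (τ : Fin d), ζ (y + ((L * N : ℕ) : ℤ) • e τ) = ζ y := by simpa [tower] using hζ
      have h := sqrt_defect_l2_le hL hN hWu hx h512 hWx ζ hζ'
      simpa [tower] using h
  | succ j ih =>
      intro W x hWu hWP hx hsm hWx ζ hζ
      obtain ⟨h512, hW₁u, hr0, hW₁x⟩ := step_small hL hWu hx hsm.1 hWx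
      -- periodicity bookkeeping: `tower (j+2) = L·tower (j+1)`
      have hWP' : IsPeriodicCfg W ((L : ℤ) * (tower L N (j + 1) : ℕ)) := by rw [← natCast_tower_succ]; exact hWP
      have hζ' : ∀ (y : Site d) (τ : Fin d), ζ (y + ((L : ℤ) * (tower L N (j + 1) : ℕ)) • e τ) = ζ y := by
        intro y τ; rw [← natCast_tower_succ]; exact hζ y τ
      have hζ'' : ∀ (y : Site d) (τ : Fin d), ζ (y + ((L * tower L N (j + 1) : ℕ) : ℤ) • e τ) = ζ y := by
        intro y τ
        have e1 : ((L * tower L N (j + 1) : ℕ) : ℤ) = (L : ℤ) * (tower L N (j + 1) : ℕ) := by push_cast; ring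
        rw [e1]; exact hζ' y τ
      have hgP : IsPeriodicDir (gaugeDir W ζ) ((L : ℤ) * (tower L N (j + 1) : ℕ)) := isPeriodicDir_gaugeDir hWP' hζ'
      obtain ⟨-, -, -, hW₁P, hQP, -⟩ := periodic_step (d := d) (Y := gaugeDir W ζ) hWP (by rw [natCast_tower_succ]; exact hgP)
      have hbP : ∀ (y : Site d) (τ : Fin d), bmeanW L W ζ (y + ((tower L N (j + 1) : ℕ) : ℤ) • e τ) = bmeanW L W ζ y :=
        fun y τ => bmeanW_add_period L hWP' hζ' y τ
      have hgbP : IsPeriodicDir (gaugeDir (cavg L W) (bmeanW L W ζ)) ((tower L N (j + 1) : ℕ) : ℤ) :=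
        isPeriodicDir_gaugeDir hW₁P hbP
      have hDP : IsPeriodicDir (fun z κ => Qstr L W (gaugeDir W ζ) z κ - gaugeDir (cavg L W) (bmeanW L W ζ) z κ)
          ((tower L N (j + 1) : ℕ) : ℤ) := fun z i κ => by simp only; rw [hQP z i κ, hgbP z i κ]
      have hT1 : 1 ≤ tower L N (j + 1) := Nat.one_le_iff_ne_zero.mpr (by
        haveI : NeZero L := ⟨by omega⟩; haveI : NeZero N := ⟨by omega⟩
        exact AveragingDeficitMultiLevelPrep.tower_ne_zero L N (j + 1))
      -- the norms
      set σ : ℝ := (Real.sqrt ((L : ℝ) ^ d))⁻¹ with hσdef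
      have hσ0 : 0 ≤ σ := by rw [hσdef]; positivity
      set S : ℝ := Real.sqrt (∑ y ∈ periodBox (d := d) (tower L N (j + 1 + 1)), ‖ζ y‖ ^ 2) with hSdef
      have hS0 : 0 ≤ S := Real.sqrt_nonneg _
      -- term 1: the IH at `cavg W` on the generator `bmeanW W ζ`
      have h1 := ih hW₁u hW₁P hr0 hsm.2 hW₁x hbP
      have hmean : Real.sqrt (∑ y ∈ periodBox (d := d) (tower L N (j + 1)), ‖bmeanW L W ζ y‖ ^ 2) ≤ σ * S := by
        have h := sum_norm_bmeanW_sq_le (d := d) hL (tower L N (j + 1)) hWu ζ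
        rw [hσdef, hSdef, show (tower L N (j + 1 + 1)) = L * tower L N (j + 1) from rfl, ← Real.sqrt_inv,
          ← Real.sqrt_mul (by positivity)]
        exact Real.sqrt_le_sqrt h
      have hD0 : 0 ≤ Real.sqrt d * DSum d L (j + 1) (prop1Radius d L x) * σ ^ (j + 1) :=
        mul_nonneg (mul_nonneg (Real.sqrt_nonneg _) (DSum_nonneg d L (j + 1) hr0)) (pow_nonneg hσ0 _)
      have h1' : Real.sqrt (l2sq (periodBox (d := d) N) (DefIter L (j + 1) (cavg L W) (bmeanW L W ζ)))
          ≤ Real.sqrt d * DSum d L (j + 1) (prop1Radius d L x) * σ ^ (j + 1) * (σ * S) :=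
        h1.trans (mul_le_mul_of_nonneg_left hmean hD0)
      -- term 2: the finest defect carried through `j+1` straight averages
      have h2a := sqrt_l2sq_QstrIter_le (d := d) hL hN j hW₁u hW₁P hr0 hsm.2 hW₁x hDP
      have h2b := sqrt_defect_l2_le hL hT1 hWu hx h512 hWx ζ hζ''
      have hρj : 0 ≤ rho d L ^ (j + 1) := pow_nonneg (rho_nonneg d L) _
      have h2 : Real.sqrt (l2sq (periodBox (d := d) N) (QstrIter L (j + 1) (cavg L W)
            (fun z κ => Qstr L W (gaugeDir W ζ) z κ - gaugeDir (cavg L W) (bmeanW L W ζ) z κ)))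
          ≤ rho d L ^ (j + 1) * (Real.sqrt d * (10 * loopRad d L x) * σ * S) := by
        refine h2a.trans (mul_le_mul_of_nonneg_left ?_ hρj)
        rw [hSdef, show (tower L N (j + 1 + 1)) = L * tower L N (j + 1) from rfl]
        exact h2b
      -- Minkowski and the algebra `ρ^{j+1}·σ = L^{j+1}·σ^{j+2}`
      rw [DefIter_succ, DSum_succ]
      refine (sqrt_l2sq_add_le _ _ _).trans ((add_le_add h1' h2).trans ?_)
      have hρσ : rho d L ^ (j + 1) * σ = (L : ℝ) ^ (j + 1) * σ ^ (j + 1 + 1) := by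
        rw [rho_eq, ← hσdef, mul_pow]; ring
      have e : rho d L ^ (j + 1) * (Real.sqrt d * (10 * loopRad d L x) * σ * S)
          = Real.sqrt d * ((L : ℝ) ^ (j + 1) * (10 * loopRad d L x)) * σ ^ (j + 1 + 1) * S := by
        calc rho d L ^ (j + 1) * (Real.sqrt d * (10 * loopRad d L x) * σ * S)
            = (rho d L ^ (j + 1) * σ) * (Real.sqrt d * (10 * loopRad d L x) * S) := by ring
          _ = ((L : ℝ) ^ (j + 1) * σ ^ (j + 1 + 1)) * (Real.sqrt d * (10 * loopRad d L x) * S) := by rw [hρσ]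
          _ = _ := by ring
      rw [e]
      have e2 : Real.sqrt d * DSum d L (j + 1) (prop1Radius d L x) * σ ^ (j + 1) * (σ * S)
          = Real.sqrt d * DSum d L (j + 1) (prop1Radius d L x) * σ ^ (j + 1 + 1) * S := by ring
      rw [e2]
      apply le_of_eq
      ring

/-! ## §3 The k-free form -/

/-- **THE ACCUMULATED DEFECT IN ℓ², k-FREE** (`L ≥ 2`): in the multi-level small-field class and for a `tower L N (j+1)`-periodic `ζ`:
`l2sq (periodBox N) (DefIter L (j+1) W ζ) ≤ d·(20·loopRad d L ((prop1Radius d L)^[j] x))²·((L^d)⁻¹)^{j+1}·Σ_{x∈periodBox (tower L N (j+1))} ‖ζ x‖²`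
— «`Σ‖def‖² ≤ C·θ²·M^{−d}·Σ‖ζ‖²`» of the design's S3, with `M^{−d} = (L^d)^{−(j+1)}` EXACT and only the top radius `r_j`. [folklore] -/
theorem l2sq_DefIter_le_of_levelSmall [Nonempty n] {L N : ℕ} (hL : 2 ≤ L) (hN : 1 ≤ N) (j : ℕ)
    {W : Site d → Fin d → (Matrix n n ℂ)ˣ} {x : ℝ} (hWu : IsUnitaryCfg W) (hWP : IsPeriodicCfg W ((tower L N (j + 1) : ℕ) : ℤ))
    (hx : 0 ≤ x) (hsm : LevelSmall d L j x) (hWx : SmallField W x)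
    {ζ : Site d → Matrix n n ℂ} (hζ : ∀ (y : Site d) (τ : Fin d), ζ (y + ((tower L N (j + 1) : ℕ) : ℤ) • e τ) = ζ y) :
    l2sq (periodBox (d := d) N) (DefIter L (j + 1) W ζ)
      ≤ (d : ℝ) * (20 * loopRad d L ((prop1Radius d L)^[j] x)) ^ 2 * (((L : ℝ) ^ d)⁻¹) ^ (j + 1)
          * ∑ y ∈ periodBox (d := d) (tower L N (j + 1)), ‖ζ y‖ ^ 2 := by
  have h := sqrt_l2sq_DefIter_le (d := d) (by omega) hN j hWu hWP hx hsm hWx hζ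
  have hD0 : 0 ≤ DSum d L (j + 1) x := DSum_nonneg d L (j + 1) hx
  have htop := DSum_le_top (d := d) hL j hx
  have hρ : 0 ≤ loopRad d L x := by unfold loopRad; positivity
  have hLj : (0 : ℝ) ≤ (L : ℝ) ^ j * (10 * loopRad d L x) := by positivity
  have hD : DSum d L (j + 1) x ≤ 20 * loopRad d L ((prop1Radius d L)^[j] x) := by linarith
  have hS0 : 0 ≤ ∑ y ∈ periodBox (d := d) (tower L N (j + 1)), ‖ζ y‖ ^ 2 := by positivity
  have hl0 : 0 ≤ l2sq (periodBox (d := d) N) (DefIter L (j + 1) W ζ) := l2sq_nonneg _ _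
  set σ : ℝ := (Real.sqrt ((L : ℝ) ^ d))⁻¹ with hσdef
  have hσ0 : 0 ≤ σ := by rw [hσdef]; positivity
  have hrhs0 : 0 ≤ Real.sqrt d * DSum d L (j + 1) x * σ ^ (j + 1)
      * Real.sqrt (∑ y ∈ periodBox (d := d) (tower L N (j + 1)), ‖ζ y‖ ^ 2) := by positivity
  -- square both sides
  have hsq := pow_le_pow_left₀ (Real.sqrt_nonneg _) h 2
  rw [Real.sq_sqrt hl0] at hsq
  refine hsq.trans ?_
  have e : (Real.sqrt d * DSum d L (j + 1) x * σ ^ (j + 1)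
        * Real.sqrt (∑ y ∈ periodBox (d := d) (tower L N (j + 1)), ‖ζ y‖ ^ 2)) ^ 2
      = (d : ℝ) * DSum d L (j + 1) x ^ 2 * (((L : ℝ) ^ d)⁻¹) ^ (j + 1) * ∑ y ∈ periodBox (d := d) (tower L N (j + 1)), ‖ζ y‖ ^ 2 := by
    rw [mul_pow, mul_pow, mul_pow, Real.sq_sqrt (Nat.cast_nonneg d), Real.sq_sqrt hS0, ← pow_mul, mul_comm (j + 1) 2, pow_mul,
      hσdef, sqrtInv_sq]
  rw [e]
  have hDsq : DSum d L (j + 1) x ^ 2 ≤ (20 * loopRad d L ((prop1Radius d L)^[j] x)) ^ 2 := pow_le_pow_left₀ hD0 hD 2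
  have hrest : 0 ≤ (((L : ℝ) ^ d)⁻¹) ^ (j + 1) * ∑ y ∈ periodBox (d := d) (tower L N (j + 1)), ‖ζ y‖ ^ 2 := by positivity
  calc (d : ℝ) * DSum d L (j + 1) x ^ 2 * (((L : ℝ) ^ d)⁻¹) ^ (j + 1) * ∑ y ∈ periodBox (d := d) (tower L N (j + 1)), ‖ζ y‖ ^ 2
      = (d : ℝ) * DSum d L (j + 1) x ^ 2 * ((((L : ℝ) ^ d)⁻¹) ^ (j + 1) * ∑ y ∈ periodBox (d := d) (tower L N (j + 1)), ‖ζ y‖ ^ 2) := by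
        ring
    _ ≤ (d : ℝ) * (20 * loopRad d L ((prop1Radius d L)^[j] x)) ^ 2
          * ((((L : ℝ) ^ d)⁻¹) ^ (j + 1) * ∑ y ∈ periodBox (d := d) (tower L N (j + 1)), ‖ζ y‖ ^ 2) :=
        mul_le_mul_of_nonneg_right (mul_le_mul_of_nonneg_left hDsq (Nat.cast_nonneg d)) hrest
    _ = _ := by ring

end

end Summit.QuantumFields.BalabanUV.T4Continuum.NE3ExactLineSumsL2
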